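/-
Copyright: statement-level skeleton of a published paper (lit-balaban cell, Phase-2 proof seat p19, gen 4). No claims beyond
what the kernel checks below.
-/
import Mathlib
import Literature.MathematicalPhysics.QuantumFieldTheory.Balaban1983to89.B3LatticeIBP
import Literature.MathematicalPhysics.QuantumFieldTheory.Balaban1983to89.B3Ineq213Amplitude

/-!
# B3 — T. Bałaban, *(Higgs)₂,₃ quantum fields in a finite volume. III. Renormalization*, CMP **88** (1983) 411–445
[Balaban1983Higgs3] — Sect. 2, p. 425: the integration by parts (2.8)/(2.9) INSIDE the amplitude model — one
integration by parts at a vertex, with the lattice Leibniz rule moving the derivative onto EVERY other factor at the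
vertex (the vertex function and the other lines), one new amplitude per factor

statement-level skeleton of published theorems with citation tags; proofs where landed; nothing here is a claim about
the Yang–Mills mass gap

PDF held: `paper:balaban1983-higgs-2-3-quantum-fields-finite-volume` (journal page = PDF page + 410); displays (2.4),
(2.8), (2.9) read on the ×2 renders `pub-balaban/b2b-balaban-ref1/pages/1983-cmp88-higgs23-III/1983-cmp88-higgs23-III-p014,
p015-x2.png` (pp. 424–425).

Part of the Phase-2 work on SKELETON rows **B3.Prop2.1 / B3.Prop2.2** (unit `lit-balaban-p19` gen 4, HOME
`run/shared/lean/pub/lit-balaban/`): the (2.4) EXCEPTION of Proposition 2.1, files `B3LatticeIBP` (lattice summation by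
parts, Leibniz rule) → `B3AmpIBP` (this file) → `B3AmpIBPAll` → `B3AmpIBPBounds` → `B3IBPDegrees` → `B3Prop21Except24`, over
the localized lattice graph amplitudes of `B3Ineq213Amplitude` (gen 3).

WHAT IS REPRODUCED.  p. 425 [PDF 15], verbatim: *"Our next step is to transform the whole expression in such a way that
these graphs are replaced by graphs with positive degrees. It can be done, e.g. by integration by parts. For a vertex in
(2.4) we have −e(L^kε) Σ_{b⊂T_η} η^d[(D^η_B̃φ′)(b)·qφ′(b₋)]g(b₋)A′_b = −e(L^kε) Σ_{x∈T_η} η^dφ′(x)·q(D^{η*}_B̃φ′gA′)(x) = −e(L^kε)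
Σ_{x∈T_η} η^d[φ′(x)·qφ′(x)]g(x)(∂^{η*}A′)(x) − e(L^kε) Σ_{x∈T_η} η^d[φ′(x)·qφ′(x)] Σ_{μ=1}^d (∂^{η*}_μ g)(x)A′_μ(x−ηe_μ) − e(L^kε)
Σ_{x∈T_η} η^d Σ_{μ=1}^d [φ′(x)·q(D^η_{B̃,μ}φ′)(x)]g(x−ηe_μ)A′_μ(x−ηe_μ), (2.8) and it can be written graphically in the following
way [(2.9): the vertex with the derivative on the propagator leg = the sum of the three vertices with the derivative (∗)
moved to the wavy leg, to the vertex, to the other scalar leg] (here we have defined the new graphical notations)."*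
KERNEL-CHECKED HERE, at the level of the raw lattice sums `rawE` of the amplitude model (`B3Ineq213Amplitude.Amp.E`:
`E_j = Σ_{x_v∈□(v)} Π_v η^d u_v(x_v) Π_l K_l(j_l; x_{s(l)}, x_{t(l)})`): **`rawE_site`** — if the kernel of the line `l₀`
(endpoints `v₀ = s(l₀) ≠ t(l₀)`) is the forward difference quotient `∂⁺_μ` in its `v₀`-variable of a kernel `K♭`, and the
vertex function `u_{v₀}` vanishes on the two `μ`-faces of `□(v₀)` (the smooth localization, p. 420, taken supported inside
the cube — the reading of `B3LatticeIBP`), then summation by parts in `x_{v₀}` (`B3LatticeIBP.sum_mul_fdiffQ_eq`) and the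
lattice Leibniz rule (`B3LatticeIBP.bdiffQ_prod`) give `E_j(u, K) = E_j(u^{(∗)}, K^{(∗)}) + Σ_{p ≠ l₀ at v₀} E_j(u^{(p)},
K^{(p)})`: in the VERTEX TERM (second graph of (2.9), the ∗ at the vertex) `u_{v₀} ↦ −∂⁻_μ u_{v₀}`, `K_{l₀} ↦ K♭`; in the TERM
OF THE LINE `p` (first/third graphs of (2.9)) the difference `∂⁻_μ` acts on the kernel `K_p` in its `v₀`-variable(s)
(`dK`), the lines at `v₀` after `p` (in the fixed order of the lines) are evaluated at the shifted point `x_{v₀} − e_μ` (`shK`;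
the arguments `x − ηe_μ` of (2.8)), `u_{v₀} ↦ −u_{v₀}(· − e_μ)`, `K_{l₀} ↦ K♭`; lines not at `v₀` contribute no term.  The data
transforms are `siteU`, `siteK` (indexed by the hit factor `o : Option (line)`, `none` = the vertex).  No estimate is made
here (see `B3AmpIBPBounds`); no hypothesis on the other lines at `v₀` is needed for the identity.
-/

open Finset

namespace Literature.MathematicalPhysics.QuantumFieldTheory.Balaban1983to89.B3Ineq213

open B3Ineq215

/-! ## Lattice calculus complements -/

section Calculus

variable {d : ℕ}

/-- `∂⁻_μ(c·f) = c·∂⁻_μ f`. [cite: Balaban1983Higgs3, (2.8) p.425] -/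
theorem bdiffQ_const_mul (s : ℝ) (μ : Fin d) (c : ℝ) (f : (Fin d → ℕ) → ℝ) (x : Fin d → ℕ) :
    bdiffQ s μ (fun y => c * f y) x = c * bdiffQ s μ f x := by
  simp only [bdiffQ]; ring

/-- The two-factor Leibniz rule for `∂⁻_μ` on the lattice: `∂⁻(fg)(x) = (∂⁻f)(x)·g(x) + f(x−e_μ)·(∂⁻g)(x)` — the second
factor unshifted where the first is differentiated, the first SHIFTED where the second is. [cite: Balaban1983Higgs3, (2.8) p.425] -/
theorem bdiffQ_mul (s : ℝ) (μ : Fin d) (f g : (Fin d → ℕ) → ℝ) (x : Fin d → ℕ) :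
    bdiffQ s μ (fun y => f y * g y) x = bdiffQ s μ f x * g x + f (bsh μ x) * bdiffQ s μ g x := by
  simp only [bdiffQ]; ring

/-- A product over a linearly ordered finite set splits at a member into the factors before, at, and after it.
[cite: Balaban1983Higgs3, (2.8) p.425] -/
theorem prod_split3 {ι R : Type*} [LinearOrder ι] [CommMonoid R] (T : Finset ι) {p : ι} (hp : p ∈ T) (F : ι → R) :
    ∏ q ∈ T, F q = (∏ q ∈ T with q < p, F q) * F p * ∏ q ∈ T with p < q, F q := by
  classical
  have hT : T = (T.filter (· < p) ∪ {p}) ∪ T.filter (p < ·) := by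
    ext q
    simp only [mem_union, mem_filter, mem_singleton]
    constructor
    · intro hq
      rcases lt_trichotomy q p with h | h | h
      · exact Or.inl (Or.inl ⟨hq, h⟩)
      · exact Or.inl (Or.inr h)
      · exact Or.inr ⟨hq, h⟩
    · rintro ((⟨hq, -⟩ | rfl) | ⟨hq, -⟩)
      · exact hq
      · exact hp
      · exact hq
  have hd1 : Disjoint (T.filter (· < p)) {p} := by
    rw [disjoint_singleton_right, mem_filter]; exact fun h => lt_irrefl _ h.2
  have hd2 : Disjoint (T.filter (· < p) ∪ {p}) (T.filter (p < ·)) := by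
    rw [disjoint_left]
    intro q hq hq'
    rw [mem_filter] at hq'
    rcases mem_union.1 hq with h | h
    · exact lt_asymm (mem_filter.1 h).2 hq'.2
    · rw [mem_singleton] at h; subst h; exact lt_irrefl _ hq'.2
  conv_lhs => rw [hT]
  rw [prod_union hd2, prod_union hd1, prod_singleton]

end Calculus

/-! ## Kernel operations: shift and difference in the variables sitting at a vertex -/

section KernelOps

variable {d : ℕ}

/-- The line kernels `K(t; x, y)` of the amplitude model (scale index, the two endpoint positions). [cite: Balaban1983Higgs3, (2.13) p.426] -/
abbrev Ker (d : ℕ) : Type := ℕ → (Fin d → ℕ) → (Fin d → ℕ) → ℝ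

/-- The kernel with the variables flagged by `bs` (first) / `bt` (second) shifted by `−e_μ` (the arguments `x − ηe_μ` of
(2.8)). [cite: Balaban1983Higgs3, (2.8) p.425] -/
def shK (μ : Fin d) (bs bt : Bool) (K : Ker d) : Ker d :=
  fun t x y => K t (if bs then bsh μ x else x) (if bt then bsh μ y else y)

/-- The backward difference quotient `∂⁻_μ` of the kernel in the flagged variables (jointly): `s·(K(x,y) − K(x♭,y♭))`,
`s = η⁻¹`. [cite: Balaban1983Higgs3, (2.8) p.425] -/
noncomputable def dK (s : ℝ) (μ : Fin d) (bs bt : Bool) (K : Ker d) : Ker d :=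
  fun t x y => s * (K t x y - shK μ bs bt K t x y)

/-- Unfolding of `shK`. [cite: Balaban1983Higgs3, (2.8) p.425] -/
theorem shK_apply (μ : Fin d) (bs bt : Bool) (K : Ker d) (t : ℕ) (x y : Fin d → ℕ) :
    shK μ bs bt K t x y = K t (if bs then bsh μ x else x) (if bt then bsh μ y else y) := rfl

/-- Unfolding of `dK`. [cite: Balaban1983Higgs3, (2.8) p.425] -/
theorem dK_apply (s : ℝ) (μ : Fin d) (bs bt : Bool) (K : Ker d) (t : ℕ) (x y : Fin d → ℕ) :
    dK s μ bs bt K t x y = s * (K t x y - shK μ bs bt K t x y) := rfl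

/-- With no flagged variable the difference vanishes. [cite: Balaban1983Higgs3, (2.8) p.425] -/
theorem dK_false_false (s : ℝ) (μ : Fin d) (K : Ker d) (t : ℕ) (x y : Fin d → ℕ) : dK s μ false false K t x y = 0 := by
  simp [dK, shK]

/-- What happens to a factor of an ordered product under the Leibniz rule: differentiated, shifted (it comes after the
differentiated one), or kept (it comes before). [cite: Balaban1983Higgs3, (2.8) p.425] -/
inductive Op
  | keep
  | shift
  | deriv
  deriving DecidableEq

/-- The action of an `Op` on a kernel in the flagged variables. [cite: Balaban1983Higgs3, (2.8) p.425] -/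
noncomputable def Op.ap (s : ℝ) (μ : Fin d) : Op → Bool → Bool → Ker d → Ker d
  | .keep, _, _, K => K
  | .shift, bs, bt, K => shK μ bs bt K
  | .deriv, bs, bt, K => dK s μ bs bt K

/-- `keep` keeps. [cite: Balaban1983Higgs3, (2.8) p.425] -/
@[simp] theorem Op.ap_keep (s : ℝ) (μ : Fin d) (bs bt : Bool) (K : Ker d) : Op.keep.ap s μ bs bt K = K := rfl

/-- `shift` shifts. [cite: Balaban1983Higgs3, (2.8) p.425] -/
@[simp] theorem Op.ap_shift (s : ℝ) (μ : Fin d) (bs bt : Bool) (K : Ker d) :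
    Op.shift.ap s μ bs bt K = shK μ bs bt K := rfl

/-- `deriv` differentiates. [cite: Balaban1983Higgs3, (2.8) p.425] -/
@[simp] theorem Op.ap_deriv (s : ℝ) (μ : Fin d) (bs bt : Bool) (K : Ker d) :
    Op.deriv.ap s μ bs bt K = dK s μ bs bt K := rfl

/-- In the term where the derivative hits the line `p`, the line `q` is differentiated (`q = p`), shifted (`q` after `p`)
or kept (`q` before `p`) — the lines at a vertex are taken in their fixed order. [cite: Balaban1983Higgs3, (2.8) p.425] -/
def opOf {m : ℕ} (p q : Fin m) : Op := if q = p then .deriv else if p < q then .shift else .keep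

/-- The hit line is differentiated. [cite: Balaban1983Higgs3, (2.8) p.425] -/
theorem opOf_self {m : ℕ} (p : Fin m) : opOf p p = .deriv := by simp [opOf]

/-- Later lines are shifted. [cite: Balaban1983Higgs3, (2.8) p.425] -/
theorem opOf_of_lt {m : ℕ} {p q : Fin m} (h : p < q) : opOf p q = .shift := by
  simp [opOf, h, ne_of_gt h]

/-- Earlier lines are kept. [cite: Balaban1983Higgs3, (2.8) p.425] -/
theorem opOf_of_gt {m : ℕ} {p q : Fin m} (h : q < p) : opOf p q = .keep := by
  simp [opOf, ne_of_lt h, not_lt.2 h.le]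

end KernelOps

/-! ## The raw amplitude and the data transforms of one integration by parts -/

section Raw

variable {V : Type} [Fintype V] [DecidableEq V] {m d : ℕ}

/-- The localized lattice graph amplitude `E(G(j), {□(v)})` of `B3Ineq213Amplitude` as a function of the raw data (lattice
constants, endpoints, unit cubes, vertex functions, kernels): `Σ_{x_v ∈ □(v)} Π_v η^d u_v(x_v) · Π_l K_l(j_l; x_{s(l)}, x_{t(l)})`.
[cite: Balaban1983Higgs3, (2.13) p.426] -/
noncomputable def rawE (L d k : ℕ) (src tgt : Fin m → V) (box : V → Fin d → ℕ) (u : V → (Fin d → ℕ) → ℝ)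
    (K : Fin m → Ker d) (j : Fin m → ℕ) : ℝ :=
  ∑ x ∈ boxPositions L k box, (∏ v, (((L : ℝ) ^ k)⁻¹) ^ d * u v (x v)) * ∏ l, K l (j l) (x (src l)) (x (tgt l))

/-- `Amp.E` is `rawE` of its data. [cite: Balaban1983Higgs3, (2.13) p.426] -/
theorem Amp.E_eq_rawE {M : Model V m} (A : Amp M) (j : Fin m → ℕ) :
    A.E j = rawE M.L M.d A.k M.src M.tgt A.box A.u A.K j := rfl

end Raw

section Site

variable {V : Type} [DecidableEq V] {m d : ℕ}

/-- The vertex functions after the integration by parts at `v₀` in the term `o`: at `v₀`, `−∂⁻_μ u_{v₀}` in the vertex term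
(`o = none`) and `−u_{v₀}(· − e_μ)` in the term of a line; unchanged elsewhere. [cite: Balaban1983Higgs3, (2.9) p.425] -/
noncomputable def siteU (v₀ : V) (μ : Fin d) (s : ℝ) (o : Option (Fin m)) (u : V → (Fin d → ℕ) → ℝ) :
    V → (Fin d → ℕ) → ℝ :=
  Function.update u v₀ fun x => o.elim (-bdiffQ s μ (u v₀) x) fun _ => -u v₀ (bsh μ x)

/-- The kernels after the integration by parts at `v₀ = s(l₀)` in the term `o`: `K♭` on `l₀`; in the term of the line `p`
the other lines are differentiated / shifted / kept in their `v₀`-variables according to `opOf p`; unchanged in the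
vertex term. [cite: Balaban1983Higgs3, (2.9) p.425] -/
noncomputable def siteK (src tgt : Fin m → V) (l₀ : Fin m) (μ : Fin d) (s : ℝ) (Kb₀ : Ker d) (o : Option (Fin m))
    (K : Fin m → Ker d) : Fin m → Ker d :=
  fun q => if q = l₀ then Kb₀ else
    o.elim (K q) fun p => (opOf p q).ap s μ (decide (src q = src l₀)) (decide (tgt q = src l₀)) (K q)

variable (v₀ : V) (μ : Fin d) (s : ℝ)

/-- Away from `v₀` the vertex functions are unchanged. [cite: Balaban1983Higgs3, (2.9) p.425] -/
@[simp] theorem siteU_of_ne {v : V} (hv : v ≠ v₀) (o : Option (Fin m)) (u : V → (Fin d → ℕ) → ℝ) :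
    siteU v₀ μ s o u v = u v := by
  simp [siteU, hv]

/-- At `v₀`, vertex term: `−∂⁻_μ u_{v₀}`. [cite: Balaban1983Higgs3, (2.9) p.425] -/
theorem siteU_none_self (u : V → (Fin d → ℕ) → ℝ) (x : Fin d → ℕ) :
    siteU v₀ μ s (none : Option (Fin m)) u v₀ x = -bdiffQ s μ (u v₀) x := by
  simp [siteU]

/-- At `v₀`, term of a line: `−u_{v₀}(x − e_μ)`. [cite: Balaban1983Higgs3, (2.9) p.425] -/
theorem siteU_some_self (p : Fin m) (u : V → (Fin d → ℕ) → ℝ) (x : Fin d → ℕ) :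
    siteU v₀ μ s (some p) u v₀ x = -u v₀ (bsh μ x) := by
  simp [siteU]

variable (src tgt : Fin m → V) (l₀ : Fin m) (Kb₀ : Ker d)

/-- On `l₀`: `K♭`. [cite: Balaban1983Higgs3, (2.9) p.425] -/
@[simp] theorem siteK_self (o : Option (Fin m)) (K : Fin m → Ker d) : siteK src tgt l₀ μ s Kb₀ o K l₀ = Kb₀ := by
  simp [siteK]

/-- Vertex term, other lines: unchanged. [cite: Balaban1983Higgs3, (2.9) p.425] -/
theorem siteK_none_of_ne {q : Fin m} (hq : q ≠ l₀) (K : Fin m → Ker d) :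
    siteK src tgt l₀ μ s Kb₀ none K q = K q := by
  simp [siteK, hq]

/-- Term of the line `p`, other lines: `opOf p q` applied in the `v₀`-variables. [cite: Balaban1983Higgs3, (2.9) p.425] -/
theorem siteK_some_of_ne {q : Fin m} (hq : q ≠ l₀) (p : Fin m) (K : Fin m → Ker d) :
    siteK src tgt l₀ μ s Kb₀ (some p) K q
      = (opOf p q).ap s μ (decide (src q = src l₀)) (decide (tgt q = src l₀)) (K q) := by
  simp [siteK, hq]

end Site

/-! ## One integration by parts at a vertex: the identity -/

section Identity

variable {V : Type} [Fintype V] [DecidableEq V] {m d : ℕ}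

/-- The summand of `rawE` at the position tuple `x`. [cite: Balaban1983Higgs3, (2.13) p.426] -/
noncomputable def summand (L k : ℕ) (src tgt : Fin m → V) (u : V → (Fin d → ℕ) → ℝ) (K : Fin m → Ker d)
    (j : Fin m → ℕ) (x : V → Fin d → ℕ) : ℝ :=
  (∏ v, (((L : ℝ) ^ k)⁻¹) ^ d * u v (x v)) * ∏ l, K l (j l) (x (src l)) (x (tgt l))

/-- `rawE = Σ_x summand x`. [cite: Balaban1983Higgs3, (2.13) p.426] -/
theorem rawE_eq_sum_summand (L k : ℕ) (src tgt : Fin m → V) (box : V → Fin d → ℕ) (u : V → (Fin d → ℕ) → ℝ)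
    (K : Fin m → Ker d) (j : Fin m → ℕ) :
    rawE L d k src tgt box u K j = ∑ x ∈ boxPositions L k box, summand L k src tgt u K j x := rfl

/-- The factor of the line `q` on the slice of the position sum where the coordinate `x_{v₀} = a` varies and the others are
frozen at `w`. [cite: Balaban1983Higgs3, (2.8) p.425] -/
def lineF (src tgt : Fin m → V) (K : Fin m → Ker d) (j : Fin m → ℕ) (w : V → Fin d → ℕ) (v₀ : V) (q : Fin m)
    (a : Fin d → ℕ) : ℝ :=
  K q (j q) (Function.update w v₀ a (src q)) (Function.update w v₀ a (tgt q))

/-- The product of the factors of the lines other than `l₀` on the slice. [cite: Balaban1983Higgs3, (2.8) p.425] -/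
def Qf (src tgt : Fin m → V) (K : Fin m → Ker d) (j : Fin m → ℕ) (w : V → Fin d → ℕ) (v₀ : V) (l₀ : Fin m)
    (a : Fin d → ℕ) : ℝ :=
  ∏ q ∈ univ.erase l₀, lineF src tgt K j w v₀ q a

/-- The product of the vertex factors other than `v₀` on the slice (independent of `a`). [cite: Balaban1983Higgs3, (2.8) p.425] -/
noncomputable def Rf (L k d : ℕ) (u : V → (Fin d → ℕ) → ℝ) (w : V → Fin d → ℕ) (v₀ : V) : ℝ :=
  ∏ v ∈ univ.erase v₀, (((L : ℝ) ^ k)⁻¹) ^ d * u v (w v)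

/-- The summand on the slice, with the coordinate `v₀ = s(l₀)` singled out: `η^d u_{v₀}(a) · K_{l₀}(a, w_{t(l₀)}) · Π_{q ≠ l₀}
K_q · Π_{v ≠ v₀} η^d u_v(w_v)`. [cite: Balaban1983Higgs3, (2.8) p.425] -/
theorem summand_update (L k : ℕ) (src tgt : Fin m → V) (u : V → (Fin d → ℕ) → ℝ) (K : Fin m → Ker d) (j : Fin m → ℕ)
    {l₀ : Fin m} (hne : src l₀ ≠ tgt l₀) (w : V → Fin d → ℕ) (a : Fin d → ℕ) :
    summand L k src tgt u K j (Function.update w (src l₀) a)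
      = ((((L : ℝ) ^ k)⁻¹) ^ d * u (src l₀) a) * K l₀ (j l₀) a (w (tgt l₀))
        * Qf src tgt K j w (src l₀) l₀ a * Rf L k d u w (src l₀) := by
  unfold summand Qf Rf lineF
  rw [← mul_prod_erase univ _ (mem_univ (src l₀)), ← mul_prod_erase univ _ (mem_univ l₀), Function.update_self,
    Function.update_of_ne hne.symm]
  have e1 : ∏ v ∈ univ.erase (src l₀), (((L : ℝ) ^ k)⁻¹) ^ d * u v (Function.update w (src l₀) a v)
      = ∏ v ∈ univ.erase (src l₀), (((L : ℝ) ^ k)⁻¹) ^ d * u v (w v) :=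
    prod_congr rfl fun v hv => by rw [Function.update_of_ne (ne_of_mem_erase hv)]
  rw [e1]
  ring

/-- The other vertex factors do not see a change of the vertex function at `v₀`. [cite: Balaban1983Higgs3, (2.8) p.425] -/
theorem Rf_siteU (L k : ℕ) (u : V → (Fin d → ℕ) → ℝ) (w : V → Fin d → ℕ) (v₀ : V) (μ : Fin d) (s : ℝ)
    (o : Option (Fin m)) : Rf L k d (siteU v₀ μ s o u) w v₀ = Rf L k d u w v₀ := by
  unfold Rf
  exact prod_congr rfl fun v hv => by rw [siteU_of_ne _ _ _ (ne_of_mem_erase hv)]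

omit [Fintype V] in
/-- In the vertex term the other line factors are unchanged. [cite: Balaban1983Higgs3, (2.9) p.425] -/
theorem Qf_siteK_none (src tgt : Fin m → V) (K : Fin m → Ker d) (j : Fin m → ℕ) (w : V → Fin d → ℕ) (l₀ : Fin m)
    (μ : Fin d) (s : ℝ) (Kb₀ : Ker d) :
    Qf src tgt (siteK src tgt l₀ μ s Kb₀ none K) j w (src l₀) l₀ = Qf src tgt K j w (src l₀) l₀ := by
  unfold Qf
  funext a
  exact prod_congr rfl fun q hq => by unfold lineF; rw [siteK_none_of_ne _ _ _ _ _ _ (ne_of_mem_erase hq)]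

omit [Fintype V] in
/-- Shifting the `v₀`-coordinate of a position tuple shifts exactly the slots sitting at `v₀`.
[cite: Balaban1983Higgs3, (2.8) p.425] -/
theorem update_slot_shift (w : V → Fin d → ℕ) (v₀ : V) (μ : Fin d) (a : Fin d → ℕ) (v : V) :
    (if decide (v = v₀) then bsh μ (Function.update w v₀ a v) else Function.update w v₀ a v)
      = Function.update w v₀ (bsh μ a) v := by
  by_cases h : v = v₀
  · subst h; simp
  · simp [h]

omit [Fintype V] in
/-- A line factor at the shifted coordinate is the shifted kernel at the slots. [cite: Balaban1983Higgs3, (2.8) p.425] -/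
theorem lineF_bsh (src tgt : Fin m → V) (K : Fin m → Ker d) (j : Fin m → ℕ) (w : V → Fin d → ℕ) (v₀ : V) (μ : Fin d)
    (q : Fin m) (a : Fin d → ℕ) :
    lineF src tgt K j w v₀ q (bsh μ a)
      = shK μ (decide (src q = v₀)) (decide (tgt q = v₀)) (K q) (j q) (Function.update w v₀ a (src q))
          (Function.update w v₀ a (tgt q)) := by
  rw [shK_apply, lineF, ← update_slot_shift w v₀ μ a (src q), ← update_slot_shift w v₀ μ a (tgt q)]

omit [Fintype V] in
/-- The difference quotient of a line factor in the coordinate `a` is the kernel differentiated at the slots.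
[cite: Balaban1983Higgs3, (2.8) p.425] -/
theorem bdiffQ_lineF (src tgt : Fin m → V) (K : Fin m → Ker d) (j : Fin m → ℕ) (w : V → Fin d → ℕ) (v₀ : V) (μ : Fin d)
    (s : ℝ) (q : Fin m) (a : Fin d → ℕ) :
    bdiffQ s μ (lineF src tgt K j w v₀ q) a
      = dK s μ (decide (src q = v₀)) (decide (tgt q = v₀)) (K q) (j q) (Function.update w v₀ a (src q))
          (Function.update w v₀ a (tgt q)) := by
  rw [dK_apply, bdiffQ_apply, ← lineF_bsh]
  rfl

omit [Fintype V] in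
/-- A line not at `v₀` contributes no Leibniz term. [cite: Balaban1983Higgs3, (2.8) p.425] -/
theorem bdiffQ_lineF_eq_zero (src tgt : Fin m → V) (K : Fin m → Ker d) (j : Fin m → ℕ) (w : V → Fin d → ℕ) (v₀ : V)
    (μ : Fin d) (s : ℝ) {q : Fin m} (hs : src q ≠ v₀) (ht : tgt q ≠ v₀) (a : Fin d → ℕ) :
    bdiffQ s μ (lineF src tgt K j w v₀ q) a = 0 := by
  rw [bdiffQ_lineF]
  simp [hs, ht, dK_false_false]

omit [Fintype V] in
/-- In the term of the line `p` the other line factors are: kept before `p`, differentiated at `p`, shifted after `p`.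
[cite: Balaban1983Higgs3, (2.9) p.425] -/
theorem Qf_siteK_some (src tgt : Fin m → V) (K : Fin m → Ker d) (j : Fin m → ℕ) (w : V → Fin d → ℕ) (l₀ : Fin m)
    (μ : Fin d) (s : ℝ) (Kb₀ : Ker d) {p : Fin m} (hp : p ∈ univ.erase l₀) (a : Fin d → ℕ) :
    Qf src tgt (siteK src tgt l₀ μ s Kb₀ (some p) K) j w (src l₀) l₀ a
      = (∏ q ∈ (univ.erase l₀) with q < p, lineF src tgt K j w (src l₀) q a)
        * bdiffQ s μ (lineF src tgt K j w (src l₀) p) a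
        * ∏ q ∈ (univ.erase l₀) with p < q, lineF src tgt K j w (src l₀) q (bsh μ a) := by
  unfold Qf
  rw [prod_split3 (univ.erase l₀) hp]
  congr 1
  · congr 1
    · refine prod_congr rfl fun q hq => ?_
      unfold lineF
      rw [siteK_some_of_ne _ _ _ _ _ _ (ne_of_mem_erase (mem_filter.1 hq).1), opOf_of_gt (mem_filter.1 hq).2, Op.ap_keep]
    · rw [bdiffQ_lineF]
      unfold lineF
      rw [siteK_some_of_ne _ _ _ _ _ _ (ne_of_mem_erase hp), opOf_self, Op.ap_deriv]
  · refine prod_congr rfl fun q hq => ?_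
    rw [lineF_bsh]
    unfold lineF
    rw [siteK_some_of_ne _ _ _ _ _ _ (ne_of_mem_erase (mem_filter.1 hq).1), opOf_of_lt (mem_filter.1 hq).2, Op.ap_shift]

/-- **The slice identity**: on the slice of the position sum where only `x_{v₀}` varies, summation by parts and the Leibniz
rule turn the original summand into the vertex term plus one term per other line at `v₀`. [cite: Balaban1983Higgs3, (2.8) p.425] -/
theorem slice_site {L k : ℕ} (hL : 0 < L) (src tgt : Fin m → V) (box : V → Fin d → ℕ) (u : V → (Fin d → ℕ) → ℝ)
    (K : Fin m → Ker d) (j : Fin m → ℕ) {l₀ : Fin m} {μ : Fin d} {s : ℝ} (Kb₀ : Ker d) (hne : src l₀ ≠ tgt l₀)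
    (hK : ∀ x y, K l₀ (j l₀) x y = fdiffQ s μ (fun x' => Kb₀ (j l₀) x' y) x)
    (hu : FaceVanishing L (⟨k, box (src l₀)⟩ : Cube d) μ (u (src l₀))) (w : V → Fin d → ℕ) :
    ∑ a ∈ pts L (⟨k, box (src l₀)⟩ : Cube d), summand L k src tgt u K j (Function.update w (src l₀) a)
      = ∑ a ∈ pts L (⟨k, box (src l₀)⟩ : Cube d),
          summand L k src tgt (siteU (src l₀) μ s (none : Option (Fin m)) u) (siteK src tgt l₀ μ s Kb₀ none K) j
            (Function.update w (src l₀) a)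
        + ∑ p ∈ (univ.erase l₀).filter (fun p => src p = src l₀ ∨ tgt p = src l₀),
            ∑ a ∈ pts L (⟨k, box (src l₀)⟩ : Cube d),
              summand L k src tgt (siteU (src l₀) μ s (some p) u) (siteK src tgt l₀ μ s Kb₀ (some p) K) j
                (Function.update w (src l₀) a) := by
  -- (1) the original slice, ready for summation by parts
  have h1 : ∀ a, summand L k src tgt u K j (Function.update w (src l₀) a)
      = ((((L : ℝ) ^ k)⁻¹) ^ d * u (src l₀) a * Qf src tgt K j w (src l₀) l₀ a * Rf L k d u w (src l₀))
          * fdiffQ s μ (fun x' => Kb₀ (j l₀) x' (w (tgt l₀))) a := by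
    intro a
    rw [summand_update L k src tgt u K j hne w a, hK]
    ring
  have hP : FaceVanishing L (⟨k, box (src l₀)⟩ : Cube d) μ
      (fun a => (((L : ℝ) ^ k)⁻¹) ^ d * u (src l₀) a * Qf src tgt K j w (src l₀) l₀ a * Rf L k d u w (src l₀)) :=
    ((hu.mul_left _).mul_right _).mul_right _
  -- (2) summation by parts, then Leibniz
  have h2 : ∀ a, bdiffQ s μ
        (fun a => (((L : ℝ) ^ k)⁻¹) ^ d * u (src l₀) a * Qf src tgt K j w (src l₀) l₀ a * Rf L k d u w (src l₀)) a
      = (((L : ℝ) ^ k)⁻¹) ^ d * Rf L k d u w (src l₀)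
          * (bdiffQ s μ (u (src l₀)) a * Qf src tgt K j w (src l₀) l₀ a
              + u (src l₀) (bsh μ a) * bdiffQ s μ (Qf src tgt K j w (src l₀) l₀) a) := by
    intro a
    have e : (fun a => (((L : ℝ) ^ k)⁻¹) ^ d * u (src l₀) a * Qf src tgt K j w (src l₀) l₀ a * Rf L k d u w (src l₀))
        = fun a => ((((L : ℝ) ^ k)⁻¹) ^ d * Rf L k d u w (src l₀)) * (u (src l₀) a * Qf src tgt K j w (src l₀) l₀ a) := by
      funext a; ring
    rw [e, bdiffQ_const_mul, bdiffQ_mul]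
  have h3 : ∀ a, bdiffQ s μ (Qf src tgt K j w (src l₀) l₀) a
      = ∑ p ∈ univ.erase l₀, (∏ q ∈ (univ.erase l₀) with q < p, lineF src tgt K j w (src l₀) q a)
          * bdiffQ s μ (lineF src tgt K j w (src l₀) p) a
          * ∏ q ∈ (univ.erase l₀) with p < q, lineF src tgt K j w (src l₀) q (bsh μ a) :=
    fun a => bdiffQ_prod (univ.erase l₀) s μ (lineF src tgt K j w (src l₀)) a
  -- (3) the terms of the lines not at `v₀` vanish
  have h4 : ∀ a, ∑ p ∈ univ.erase l₀, (∏ q ∈ (univ.erase l₀) with q < p, lineF src tgt K j w (src l₀) q a)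
          * bdiffQ s μ (lineF src tgt K j w (src l₀) p) a
          * ∏ q ∈ (univ.erase l₀) with p < q, lineF src tgt K j w (src l₀) q (bsh μ a)
      = ∑ p ∈ (univ.erase l₀).filter (fun p => src p = src l₀ ∨ tgt p = src l₀),
          (∏ q ∈ (univ.erase l₀) with q < p, lineF src tgt K j w (src l₀) q a)
          * bdiffQ s μ (lineF src tgt K j w (src l₀) p) a
          * ∏ q ∈ (univ.erase l₀) with p < q, lineF src tgt K j w (src l₀) q (bsh μ a) := by
    intro a
    symm
    refine sum_subset (filter_subset _ _) fun p hp hp' => ?_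
    have hs : ¬ (src p = src l₀ ∨ tgt p = src l₀) := fun h => hp' (mem_filter.2 ⟨hp, h⟩)
    push Not at hs
    rw [bdiffQ_lineF_eq_zero src tgt K j w (src l₀) μ s hs.1 hs.2 a, mul_zero, zero_mul]
  -- (4) the transformed slices
  have h5 : ∀ a, summand L k src tgt (siteU (src l₀) μ s (none : Option (Fin m)) u) (siteK src tgt l₀ μ s Kb₀ none K) j
        (Function.update w (src l₀) a)
      = ((((L : ℝ) ^ k)⁻¹) ^ d * (-bdiffQ s μ (u (src l₀)) a)) * Kb₀ (j l₀) a (w (tgt l₀))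
          * Qf src tgt K j w (src l₀) l₀ a * Rf L k d u w (src l₀) := by
    intro a
    rw [summand_update L k src tgt _ _ j hne w a, siteK_self, siteU_none_self, Qf_siteK_none, Rf_siteU]
  have h6 : ∀ a, ∀ p ∈ (univ.erase l₀).filter (fun p => src p = src l₀ ∨ tgt p = src l₀),
      summand L k src tgt (siteU (src l₀) μ s (some p) u) (siteK src tgt l₀ μ s Kb₀ (some p) K) j
        (Function.update w (src l₀) a)
      = ((((L : ℝ) ^ k)⁻¹) ^ d * (-u (src l₀) (bsh μ a))) * Kb₀ (j l₀) a (w (tgt l₀))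
          * ((∏ q ∈ (univ.erase l₀) with q < p, lineF src tgt K j w (src l₀) q a)
              * bdiffQ s μ (lineF src tgt K j w (src l₀) p) a
              * ∏ q ∈ (univ.erase l₀) with p < q, lineF src tgt K j w (src l₀) q (bsh μ a))
          * Rf L k d u w (src l₀) := by
    intro a p hp
    rw [summand_update L k src tgt _ _ j hne w a, siteK_self, siteU_some_self,
      Qf_siteK_some src tgt K j w l₀ μ s Kb₀ (mem_filter.1 hp).1, Rf_siteU]
  -- (5) assemble (the algebra of one slice point, the sum over the hit lines treated as an atom)
  have halg : ∀ (c R Du Q ush Kb : ℝ) (T : Fin m → ℝ) (F : Finset (Fin m)),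
      -(c * R * (Du * Q + ush * ∑ p ∈ F, T p)) * Kb = c * -Du * Kb * Q * R + ∑ p ∈ F, c * -ush * Kb * T p * R := by
    intro c R Du Q ush Kb T F
    have e : ∑ p ∈ F, c * -ush * Kb * T p * R = (c * -ush * Kb * R) * ∑ p ∈ F, T p := by
      rw [mul_sum]; exact sum_congr rfl fun p _ => by ring
    rw [e]; ring
  calc ∑ a ∈ pts L (⟨k, box (src l₀)⟩ : Cube d), summand L k src tgt u K j (Function.update w (src l₀) a)
      = ∑ a ∈ pts L (⟨k, box (src l₀)⟩ : Cube d),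
          ((((L : ℝ) ^ k)⁻¹) ^ d * u (src l₀) a * Qf src tgt K j w (src l₀) l₀ a * Rf L k d u w (src l₀))
            * fdiffQ s μ (fun x' => Kb₀ (j l₀) x' (w (tgt l₀))) a := sum_congr rfl fun a _ => h1 a
    _ = ∑ a ∈ pts L (⟨k, box (src l₀)⟩ : Cube d),
          (-bdiffQ s μ (fun a => (((L : ℝ) ^ k)⁻¹) ^ d * u (src l₀) a * Qf src tgt K j w (src l₀) l₀ a
              * Rf L k d u w (src l₀)) a) * Kb₀ (j l₀) a (w (tgt l₀)) := sum_mul_fdiffQ_eq hL hP s _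
    _ = ∑ a ∈ pts L (⟨k, box (src l₀)⟩ : Cube d),
          (summand L k src tgt (siteU (src l₀) μ s (none : Option (Fin m)) u) (siteK src tgt l₀ μ s Kb₀ none K) j
              (Function.update w (src l₀) a)
            + ∑ p ∈ (univ.erase l₀).filter (fun p => src p = src l₀ ∨ tgt p = src l₀),
                summand L k src tgt (siteU (src l₀) μ s (some p) u) (siteK src tgt l₀ μ s Kb₀ (some p) K) j
                  (Function.update w (src l₀) a)) := by
        refine sum_congr rfl fun a _ => ?_
        rw [h2 a, h3 a, h4 a, h5 a, sum_congr rfl (h6 a)]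
        exact halg _ _ _ _ _ _ _ _
    _ = _ := by rw [sum_add_distrib, sum_comm]

/-- **One integration by parts at a vertex, (2.8)/(2.9) in the amplitude model.**  If the kernel of the line `l₀` (with
`s(l₀) ≠ t(l₀)`) is the forward difference quotient `∂⁺_μ` of `K♭` in its first variable and the vertex function at
`v₀ = s(l₀)` vanishes on the two `μ`-faces of `□(v₀)`, then `E_j(u, K) = E_j(u^{(∗)}, K^{(∗)}) + Σ_{p ≠ l₀ at v₀}
E_j(u^{(p)}, K^{(p)})` — the vertex term and one term per other line at `v₀`, with the data transforms `siteU`, `siteK`.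
[cite: Balaban1983Higgs3, (2.8) p.425] -/
theorem rawE_site {L k : ℕ} (hL : 0 < L) (src tgt : Fin m → V) (box : V → Fin d → ℕ) (u : V → (Fin d → ℕ) → ℝ)
    (K : Fin m → Ker d) (j : Fin m → ℕ) {l₀ : Fin m} {μ : Fin d} {s : ℝ} (Kb₀ : Ker d) (hne : src l₀ ≠ tgt l₀)
    (hK : ∀ x y, K l₀ (j l₀) x y = fdiffQ s μ (fun x' => Kb₀ (j l₀) x' y) x)
    (hu : FaceVanishing L (⟨k, box (src l₀)⟩ : Cube d) μ (u (src l₀))) :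
    rawE L d k src tgt box u K j
      = rawE L d k src tgt box (siteU (src l₀) μ s (none : Option (Fin m)) u) (siteK src tgt l₀ μ s Kb₀ none K) j
        + ∑ p ∈ (univ.erase l₀).filter (fun p => src p = src l₀ ∨ tgt p = src l₀),
            rawE L d k src tgt box (siteU (src l₀) μ s (some p) u) (siteK src tgt l₀ μ s Kb₀ (some p) K) j := by
  classical
  obtain ⟨c, hc⟩ := pts_nonempty hL (⟨k, box (src l₀)⟩ : Cube d)
  -- Fubini: the coordinate `v₀` summed innermost
  have key : ∀ g : (V → Fin d → ℕ) → ℝ, ∑ x ∈ boxPositions L k box, g x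
      = ∑ w ∈ Fintype.piFinset (Function.update (fun v => pts L (⟨k, box v⟩ : Cube d)) (src l₀) {c}),
          ∑ a ∈ pts L (⟨k, box (src l₀)⟩ : Cube d), g (Function.update w (src l₀) a) := by
    intro g
    unfold boxPositions
    rw [Literature.AlgebraicTopology.CellComplexes.CubicalTorus.sum_piFinset_update
      (Function.update (fun v => pts L (⟨k, box v⟩ : Cube d)) (src l₀) {c}) (src l₀)
      (Function.update_self (src l₀) {c} _) (pts L (⟨k, box (src l₀)⟩ : Cube d)) g,
      Function.update_idem, Function.update_eq_self]
  have hr : ∀ (u' : V → (Fin d → ℕ) → ℝ) (K' : Fin m → Ker d), rawE L d k src tgt box u' K' j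
      = ∑ w ∈ Fintype.piFinset (Function.update (fun v => pts L (⟨k, box v⟩ : Cube d)) (src l₀) {c}),
          ∑ a ∈ pts L (⟨k, box (src l₀)⟩ : Cube d), summand L k src tgt u' K' j (Function.update w (src l₀) a) :=
    fun u' K' => by rw [rawE_eq_sum_summand, key]
  have hc : ∑ p ∈ (univ.erase l₀).filter (fun p => src p = src l₀ ∨ tgt p = src l₀),
      ∑ w ∈ Fintype.piFinset (Function.update (fun v => pts L (⟨k, box v⟩ : Cube d)) (src l₀) {c}),
        ∑ a ∈ pts L (⟨k, box (src l₀)⟩ : Cube d),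
          summand L k src tgt (siteU (src l₀) μ s (some p) u) (siteK src tgt l₀ μ s Kb₀ (some p) K) j
            (Function.update w (src l₀) a)
      = ∑ w ∈ Fintype.piFinset (Function.update (fun v => pts L (⟨k, box v⟩ : Cube d)) (src l₀) {c}),
          ∑ p ∈ (univ.erase l₀).filter (fun p => src p = src l₀ ∨ tgt p = src l₀),
            ∑ a ∈ pts L (⟨k, box (src l₀)⟩ : Cube d),
              summand L k src tgt (siteU (src l₀) μ s (some p) u) (siteK src tgt l₀ μ s Kb₀ (some p) K) j
                (Function.update w (src l₀) a) := sum_comm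
  rw [hr, hr]
  simp only [hr]
  rw [hc, ← sum_add_distrib]
  exact sum_congr rfl fun w _ => slice_site hL src tgt box u K j Kb₀ hne hK hu w

end Identity

end Literature.MathematicalPhysics.QuantumFieldTheory.Balaban1983to89.B3Ineq213
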